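import Literature.Computability.AlgebraicComplexity.BLMW11StabilityInheritance
import Literature.Computability.AlgebraicComplexity.OrbitClosureInheritance
import Literature.Computability.AlgebraicComplexity.Hyperdeterminant
import Literature.RingTheory.SymmetricFunctions.SchurBranching
import Mathlib.Algebra.MvPolynomial.Funext
import HarnessLib

/-!
# BLMW 2011, Prop. 6.3.1 (1), the complementary clause — discharge of
# `BLMW2011_prop_6_3_1_i_inf_eq_bot`; Prop. 4.5.4 (Pieri, character form) — discharge of
# `BLMW2011_prop_4_5_4_character`

Sibling proofs file of `BLMW11StabilityInheritance.lean` (val-lit cell, D-0074 GROUP L, row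
`BLMW11-A`; P. Bürgisser, J. M. Landsberg, L. Manivel, J. Weyman, SIAM J. Comput. 40 (2011),
Prop. 6.3.1 (1) = [Weyman] §7.2: "The ideal `I(Sub_a(S^dW))` is the span of all submodules `S_πW^*`
in `Sym(S^dW^*)` for which `ℓ(π) > a`"). The parent file types the half of that statement the tree
did not yet prove: a highest-weight vector of `k[S^mW]` (`coordRep τ ℂ m`) whose weight `ψ` is
supported on `range ι` (type `π` with `ℓ(π) ≤ a`, `ι : σ → τ` the inclusion of the top `a = |σ|`
letters) lies in `I(Sub_a) = subVanishingIdeal ℂ ι m` only if it is zero — the named fact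
`BLMW2011_prop_6_3_1_i_inf_eq_bot`. It is PROVED here (`BLMW2011_prop_6_3_1_i_inf_eq_bot_holds`).

Proof (elementary; the tree's inheritance machinery of `OrbitClosureInheritance.lean`, BLMW
Prop. 6.3.2): a weight supported on `range ι` is `χ` extended by zero for `χ = ψ ∘ ι`; the
highest-weight vectors of that weight are exactly the renamings `ι F` of highest-weight vectors
`F` of `k[S^m k^σ]` (`highestWeightSpace_extend_eq_map`), and `ι F ∈ I(GL_τ · ι q) ↔ F ∈ I(GL_σ · q)`
(`rename_mem_orbitVanishingIdeal_rename_iff`); so `ι F ∈ I(Sub_a) = ⨅_q I(GL_τ · ι q)` forces `F` to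
vanish on (the orbit of) EVERY form `q ∈ S^m k^σ`, i.e. at every point of `S^m k^σ`
(`exists_formCoeff_eq`), hence `F = 0` (`MvPolynomial.funext`, `ℂ` infinite). No highest-weight
theory beyond the cited lemmas is used. Typed literature; `VP ≠ VNP` is not proved and nothing
here is progress on it.

**Second discharge (appended): BLMW 2011, Prop. 4.5.4 in character form —
`BLMW2011_prop_4_5_4_character_holds`.** The parent file vendors the Pieri formula
"`S_π(A ⊕ A') = ⊕_{π ↦ π'} S_{π'}A ⊗ S^{|π|-|π'|}A'` (`dim A' = 1`), `π ↦ π'` meaning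
`π₁ ≥ π'₁ ≥ π₂ ≥ π'₂ ≥ ⋯ ≥ 0`" at the level of characters: the branching rule
`s_π(x₁, …, x_N, y) = ∑_{π ↦ π'} s_{π'}(x) y^{|π|-|π'|}` for the tree's Jacobi–Trudi Schur
polynomials, in any commutative ring. That identity is now PROVED in
`Literature/RingTheory/SymmetricFunctions/SchurBranching.lean`
(`SymmPoly.schur_snoc_eq_sum_interlacing`: Laplace expansion of `a_{π+ρ}(x, y)` along `y`, the dual
Pieri rule, a coordinatewise sign count, cancellation of `a_ρ ≠ 0` at the generic point — Macdonald,
*Symmetric Functions*, Ch. I §5 (5.9)–(5.11)), and the named fact is literally that statement.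

## References
* [BurgisserEtAl2011] P. Bürgisser, J. M. Landsberg, L. Manivel, J. Weyman, *An overview of
  mathematical issues arising in the geometric complexity theory approach to VP ≠ VNP*, SIAM J.
  Comput. 40 (2011), Prop. 6.3.1 (1) (arXiv:0907.2850v1: Prop. 6.7, held chunk p0013), Prop. 6.3.2.
* [Weyman2003] J. Weyman, *Cohomology of vector bundles and syzygies*, CUP 2003, §7.2.
* [Macdonald1995] I. G. Macdonald, *Symmetric Functions and Hall Polynomials*, 2nd ed. (1995), Ch. I
  §5 (5.9)–(5.11) (branching rule), (5.16) (Pieri's formula).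
-/

noncomputable section

open MvPolynomial

namespace Literature.Computability.AlgebraicComplexity

open _root_.Literature.NumberTheory.DiophantineGeometry
open _root_.Literature.Barriers.ValiantsHypothesis (degIdxMap degIdxMap_injective)

/-- **A coordinate polynomial on `S^m k^σ` that vanishes on the `GL_σ`-orbit of every polynomial
is zero** (infinite field): the orbits cover `S^m k^σ` (every coefficient vector is `formCoeff q`
for a form `q`, `exists_formCoeff_eq`, and `q = 1 · q` lies in its own orbit), so such a polynomial
vanishes identically (`MvPolynomial.funext`). Private helper. [folklore] -/
private theorem eq_zero_of_forall_mem_orbitVanishingIdeal {k : Type*} [Field k] [Infinite k]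
    {σ : Type*} [Fintype σ] [LinearOrder σ] {m : ℕ} {F : MvPolynomial (DegIdx σ m) k}
    (h : ∀ q : MvPolynomial σ k, F ∈ orbitVanishingIdeal q m) : F = 0 := by
  classical
  apply MvPolynomial.funext
  intro w
  obtain ⟨q, -, hq⟩ := exists_formCoeff_eq (k := k) w
  have h1 := mem_orbitVanishingIdeal_iff.mp (h q) 1
  rw [map_one, Module.End.one_apply, hq] at h1
  rw [map_zero, ← coe_aeval_eq_eval]
  exact h1

/-- **BLMW 2011, Prop. 6.3.1 (1), complementary clause — the named fact
`BLMW2011_prop_6_3_1_i_inf_eq_bot` holds**: for `ι : σ → τ` strictly monotone onto an upper set,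
`m ≠ 0`, and a weight `ψ` of `GL_τ` vanishing off `range ι`, the highest-weight vectors of
`k[S^m k^τ]` of weight `ψ` meet the ideal of the subspace variety `I(Sub_{|σ|}) = subVanishingIdeal ℂ ι m`
only in `0` ("`I(Sub_a)` is the span of the `S_πW^*` with `ℓ(π) > a`" — so no `S_πW^*` with
`ℓ(π) ≤ a` lies in it). [cite: BurgisserEtAl2011, Prop. 6.3.1 (1)] -/
theorem BLMW2011_prop_6_3_1_i_inf_eq_bot_holds : BLMW2011_prop_6_3_1_i_inf_eq_bot := by
  intro σ τ _ _ _ _ ι hι hup m hm ψ hψ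
  classical
  haveI : Infinite ℂ := CharZero.infinite ℂ
  set χ : Weight σ := fun i => ψ (ι i) with hχ
  have hext : Function.extend ι χ 0 = ψ := by
    funext x
    by_cases hx : x ∈ Set.range ι
    · obtain ⟨i, rfl⟩ := hx
      rw [hι.injective.extend_apply]
    · rw [extend_apply_of_not_mem_range χ hx, hψ x hx]
  rw [← hext, eq_bot_iff]
  intro G hG
  obtain ⟨hG1, hG2⟩ := Submodule.mem_inf.mp hG
  rw [highestWeightSpace_extend_eq_map hι hup χ] at hG1
  obtain ⟨F, -, rfl⟩ := Submodule.mem_map.mp hG1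
  have hFq : ∀ q : MvPolynomial σ ℂ, F ∈ orbitVanishingIdeal q m := by
    intro q
    rw [Submodule.restrictScalars_mem] at hG2
    exact (rename_mem_orbitVanishingIdeal_rename_iff hι.injective q F).mp (subVanishingIdeal_le q hG2)
  rw [Submodule.mem_bot, eq_zero_of_forall_mem_orbitVanishingIdeal hFq, map_zero]

/-- **BLMW 2011, Prop. 4.5.4 (Pieri formula), character form — the named fact
`BLMW2011_prop_4_5_4_character` holds**: for `λ = (λ₀ ≥ ⋯ ≥ λ_N)` and `x ∈ R^N`, `y ∈ R`
(`R` any commutative ring), `s_λ(x₁, …, x_N, y) = ∑_{μ} s_μ(x) · y^{|λ|-|μ|}`, the sum over the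
`μ ∈ ℕ^N` interlacing `λ` (`λ_{i+1} ≤ μ_i ≤ λ_i`, all `μ_i ≤ λ₀`) — the character of
`S_λ(A ⊕ A') = ⊕_{λ ↦ μ} S_μ A ⊗ S^{|λ|-|μ|} A'` on the torus `diag(x₁, …, x_N, y)`. This is the
tree's `SymmPoly.schur_snoc_eq_sum_interlacing` (`SchurBranching.lean`).
[cite: BurgisserEtAl2011, Prop. 4.5.4] [cite: Macdonald1995, Ch. I §5 (5.9)–(5.11)] -/
theorem BLMW2011_prop_4_5_4_character_holds : BLMW2011_prop_4_5_4_character :=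
  fun x y la hla =>
    _root_.Literature.RingTheory.SymmetricFunctions.SymmPoly.schur_snoc_eq_sum_interlacing x y la hla

end Literature.Computability.AlgebraicComplexity
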